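import Mathlib
import HarnessLib
import Summits.FinalStateConjecture.Statement
import Literature.Geometry.Lorentzian.WeightedNorms
import Literature.Geometry.Lorentzian.KerrData
import Literature.Geometry.Lorentzian.LeviCivita

/-!
# Route PhaseMixingCapture — the Assembly, frame form (item stmt-FinalStateConjecture-9955)

The assembly item of route `PhaseMixingCapture` for the Final State Conjecture is the curried
statement

`NearExtremalKappaCapture → BulkKerrCapture → WeakCosmicCensorshipMGHD → CaptureSuffices → FinalStateConjecture`

with `CaptureSuffices := NearExtremalKappaCapture → BulkKerrCapture → WeakCosmicCensorshipMGHD →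
FinalStateConjecture` (the large-data front end, filed as ONE typed conditional crux). It is pure
logic: modus ponens through the conditional crux — literally the route file's sorry-free deciding
theorem `Summit.FinalStateConjecture.FinalStateConjecture.Theses.PhaseMixingCapture.closes`
(candidate one-liners attached to the item by the route-review refuters and the grounder:
`fun h₁ h₂ h₃ h₄ ↦ h₄ h₁ h₂ h₃`).

Design constraint (why this file does NOT import the route module
`Summits.FinalStateConjecture.FinalStateConjecture.Theses.PhaseMixingCapture`): when an item closes,
the gate re-renders the route file with `import <closing module>` and
`theorem Assembly_holds : Assembly := …`; a closing module that itself imports the route module makes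
that render fail (import cycle — the rev-3/4 episodes of the sibling routes `PhotonSphereChannels`,
stmt-FinalStateConjecture-10050, and `EIHFluxBalance`, stmt-FinalStateConjecture-10169, each of which
cost a route repair). So the theorem below is stated with the three capture/censorship statements
INLINED VERBATIM (the bodies of `NearExtremalKappaCapture`, `BulkKerrCapture` and
`WeakCosmicCensorshipMGHD`, copied from the route file rev of 2026-08-16, and `CaptureSuffices`
unfolded to its definiens over the same bodies), so that its type is definitionally (by `δ`-unfolding
only) the route decl `Summit.FinalStateConjecture.FinalStateConjecture.Theses.PhaseMixingCapture.Assembly`,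
and the route file can import this module without a cycle. Imports are exactly those of the route
file minus `HarnessLib.Audit`. No analysis, no new definitions.
-/

namespace Summit.FinalStateConjecture.FinalStateConjecture.Theorems

open scoped BigOperators Topology Manifold Classical MeasureTheory ProbabilityTheory Matrix InnerProductSpace ComplexConjugate ContinuousMap
open Filter Set Function TopologicalSpace MeasureTheory

/-- **Assembly of route PhaseMixingCapture, frame form** (item stmt-FinalStateConjecture-9955):
`X_near → X_bulk → W → (X_near → X_bulk → W → FinalStateConjecture) → FinalStateConjecture` with
X_near = `NearExtremalKappaCapture` (κ-explicit nonlinear capture by sub-extremal Kerr on the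
near-extremal spin range a₁M ≤ |a| < M: basin `c·(1 − (a/M)²)^γ`, modulus
`C·(1 − (a/M)²)^(−p)·√dist`, complete 𝓘⁺ in sojourn form from the far region of the Kerr–Schild
slice, C^k convergence to a sub-extremal Kerr exterior), X_bulk = `BulkKerrCapture` (the same capture
with plain constants, uniform on every compact spin range |a| ≤ a₁M) and W = `WeakCosmicCensorshipMGHD`
(Christodoulou-generically in the admissible vacuum data an MGHD exists and every MGHD has complete
𝓘⁺), all three written out verbatim, and the fourth hypothesis the definiens of the conditional crux
`CaptureSuffices` over the same bodies — so that this type unfolds to the route decl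
`Summit.FinalStateConjecture.FinalStateConjecture.Theses.PhaseMixingCapture.Assembly` by `δ`-reduction
alone. Proof: modus ponens (`fun h₁ h₂ h₃ h₄ ↦ h₄ h₁ h₂ h₃`), i.e. the route's deciding theorem
`closes`. -/
theorem PhaseMixingCapture.assembly_frame_proof :
    (∀ [Literature.Geometry.Lorentzian.Kerr.Facts] [Literature.Geometry.Lorentzian.Kerr.SliceFacts], ∃ (s : ℕ) (δ : ℝ) (k : ℕ) (γ p a₁ : ℝ), a₁ < 1 ∧ ∀ (M : ℝ) (hM : 0 < M), ∃ c > (0 : ℝ), ∃ C : ℝ, ∀ a : ℝ, a₁ * M ≤ |a| → Literature.Geometry.Lorentzian.Kerr.IsSubextremal M a → ∀ (D : Literature.Geometry.Lorentzian.InitialDataSet 𝓘(ℝ, Literature.Geometry.Lorentzian.E3) (Literature.Geometry.Lorentzian.Kerr.slice a M)) [D.metric.HasLeviCivita], D.IsVacuumConstraintSolution → Literature.Geometry.Lorentzian.InitialDataSet.dataWeightedSobolevEDist s δ D (Literature.Geometry.Lorentzian.Kerr.data M a M hM.le) < ENNReal.ofReal (c * (1 - (a / M) ^ 2) ^ γ)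 → ∀ 𝒟 : Literature.Geometry.Lorentzian.VacuumCauchyDevelopment D, 𝒟.IsMaximal → ∃ (M' a' : ℝ) (𝒟oc : Set 𝒟.carrier), Literature.Geometry.Lorentzian.Kerr.IsSubextremal M' a' ∧ (∀ [𝒟.metric.HasLeviCivita], ∃ B₀ : Set (Literature.Geometry.Lorentzian.Kerr.slice a M), IsCompact B₀ ∧ ∀ σ : ℝ, 0 < σ → ∃ B₁ : Set (Literature.Geometry.Lorentzian.Kerr.slice a M), IsCompact B₁ ∧ ∀ q ∈ {q : Literature.Geometry.Lorentzian.Kerr.slice a M | Literature.Geometry.Lorentzian.Kerr.afRadius a M + 1 ≤ ‖(q : Literature.Geometry.Lorentzian.E3)‖}, q ∉ B₁ → ∀ (ray : ℝ → 𝒟.carrier) (dom : Set ℝ), 𝒟.metric.IsNormalisedNullRayFrom 𝒟.timeOrientation 𝒟.embed 𝒟.normal q ray dom → ¬ BddAbove dom ∨ ENNReal.ofReal σ ≤ Literature.Geometry.Lorentzian.sojournTime ray dom (𝒟.metric.causalFuture 𝒟.timeOrientation (𝒟.embed '' B₀))) ∧ 𝒟.toSpacetime.ConvergesToKerr 𝒟oc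 M' a' k ∧ |M' - M| + |a' - a| ≤ C * (1 - (a / M) ^ 2) ^ (-p) * √(Literature.Geometry.Lorentzian.InitialDataSet.dataWeightedSobolevEDist s δ D (Literature.Geometry.Lorentzian.Kerr.data M a M hM.le)).toReal) → (∀ [Literature.Geometry.Lorentzian.Kerr.Facts] [Literature.Geometry.Lorentzian.Kerr.SliceFacts], ∀ a₁ : ℝ, a₁ < 1 → ∃ (s : ℕ) (δ : ℝ) (k : ℕ), ∀ (M : ℝ) (hM : 0 < M), ∃ ε > (0 : ℝ), ∃ C : ℝ, ∀ a : ℝ, |a| ≤ a₁ * M → ∀ (D : Literature.Geometry.Lorentzian.InitialDataSet 𝓘(ℝ, Literature.Geometry.Lorentzian.E3) (Literature.Geometry.Lorentzian.Kerr.slice a M)) [D.metric.HasLeviCivita], D.IsVacuumConstraintSolution → Literature.Geometry.Lorentzian.InitialDataSet.dataWeightedSobolevEDist s δ D (Literature.Geometry.Lorentzian.Kerr.data M a M hM.le) < ENNReal.ofReal ε → ∀ 𝒟 : Literature.Geometry.Lorentzian.VacuumCauchyDevelopment D, 𝒟.IsMaximal → ∃ (M' a' : ℝ) (𝒟oc :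 Set 𝒟.carrier), Literature.Geometry.Lorentzian.Kerr.IsSubextremal M' a' ∧ (∀ [𝒟.metric.HasLeviCivita], ∃ B₀ : Set (Literature.Geometry.Lorentzian.Kerr.slice a M), IsCompact B₀ ∧ ∀ σ : ℝ, 0 < σ → ∃ B₁ : Set (Literature.Geometry.Lorentzian.Kerr.slice a M), IsCompact B₁ ∧ ∀ q ∈ {q : Literature.Geometry.Lorentzian.Kerr.slice a M | Literature.Geometry.Lorentzian.Kerr.afRadius a M + 1 ≤ ‖(q : Literature.Geometry.Lorentzian.E3)‖}, q ∉ B₁ → ∀ (ray : ℝ → 𝒟.carrier) (dom : Set ℝ), 𝒟.metric.IsNormalisedNullRayFrom 𝒟.timeOrientation 𝒟.embed 𝒟.normal q ray dom → ¬ BddAbove dom ∨ ENNReal.ofReal σ ≤ Literature.Geometry.Lorentzian.sojournTime ray dom (𝒟.metric.causalFuture 𝒟.timeOrientation (𝒟.embed '' B₀))) ∧ 𝒟.toSpacetime.ConvergesToKerr 𝒟oc M' a' k ∧ |M' - M| + |a' - a| ≤ C * √(Literature.Geometry.Lorentzian.InitialDataSet.dataWeightedSobolevEDist s δ D (Literature.Geometry.Lorentzian.Kerr.data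 M a M hM.le)).toReal) → (∀ (X : Type) [TopologicalSpace X] [ChartedSpace Literature.Geometry.Lorentzian.E3 X] [IsManifold (𝓡 3) ((⊤ : ℕ∞) : WithTop ℕ∞) X] [T2Space X] [SecondCountableTopology X] [ConnectedSpace X], Literature.Geometry.Lorentzian.InitialDataSet.IsChristodoulouGeneric (Literature.Geometry.Lorentzian.admissibleVacuumData X) (fun D ↦ (∃ 𝒟 : Literature.Geometry.Lorentzian.VacuumCauchyDevelopment D, 𝒟.IsMaximal) ∧ ∀ 𝒟 : Literature.Geometry.Lorentzian.VacuumCauchyDevelopment D, 𝒟.IsMaximal → Summit.FinalStateConjecture.HasCompleteNullInfinity 𝒟.toCauchyDevelopment) 1) → ((∀ [Literature.Geometry.Lorentzian.Kerr.Facts] [Literature.Geometry.Lorentzian.Kerr.SliceFacts], ∃ (s : ℕ) (δ : ℝ) (k : ℕ) (γ p a₁ : ℝ), a₁ < 1 ∧ ∀ (M : ℝ) (hM : 0 < M), ∃ c > (0 : ℝ), ∃ C : ℝ, ∀ a : ℝ, a₁ * M ≤ |a| → Literature.Geometry.Lorentzian.Kerr.IsSubextremal M a → ∀ (D : Literature.Geometry.Lorentzian.InitialDataSet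 𝓘(ℝ, Literature.Geometry.Lorentzian.E3) (Literature.Geometry.Lorentzian.Kerr.slice a M)) [D.metric.HasLeviCivita], D.IsVacuumConstraintSolution → Literature.Geometry.Lorentzian.InitialDataSet.dataWeightedSobolevEDist s δ D (Literature.Geometry.Lorentzian.Kerr.data M a M hM.le) < ENNReal.ofReal (c * (1 - (a / M) ^ 2) ^ γ) → ∀ 𝒟 : Literature.Geometry.Lorentzian.VacuumCauchyDevelopment D, 𝒟.IsMaximal → ∃ (M' a' : ℝ) (𝒟oc : Set 𝒟.carrier), Literature.Geometry.Lorentzian.Kerr.IsSubextremal M' a' ∧ (∀ [𝒟.metric.HasLeviCivita], ∃ B₀ : Set (Literature.Geometry.Lorentzian.Kerr.slice a M), IsCompact B₀ ∧ ∀ σ : ℝ, 0 < σ → ∃ B₁ : Set (Literature.Geometry.Lorentzian.Kerr.slice a M), IsCompact B₁ ∧ ∀ q ∈ {q : Literature.Geometry.Lorentzian.Kerr.slice a M | Literature.Geometry.Lorentzian.Kerr.afRadius a M + 1 ≤ ‖(q : Literature.Geometry.Lorentzian.E3)‖}, q ∉ B₁ → ∀ (ray : ℝ → 𝒟.carrier)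 (dom : Set ℝ), 𝒟.metric.IsNormalisedNullRayFrom 𝒟.timeOrientation 𝒟.embed 𝒟.normal q ray dom → ¬ BddAbove dom ∨ ENNReal.ofReal σ ≤ Literature.Geometry.Lorentzian.sojournTime ray dom (𝒟.metric.causalFuture 𝒟.timeOrientation (𝒟.embed '' B₀))) ∧ 𝒟.toSpacetime.ConvergesToKerr 𝒟oc M' a' k ∧ |M' - M| + |a' - a| ≤ C * (1 - (a / M) ^ 2) ^ (-p) * √(Literature.Geometry.Lorentzian.InitialDataSet.dataWeightedSobolevEDist s δ D (Literature.Geometry.Lorentzian.Kerr.data M a M hM.le)).toReal) → (∀ [Literature.Geometry.Lorentzian.Kerr.Facts] [Literature.Geometry.Lorentzian.Kerr.SliceFacts], ∀ a₁ : ℝ, a₁ < 1 → ∃ (s : ℕ) (δ : ℝ) (k : ℕ), ∀ (M : ℝ) (hM : 0 < M), ∃ ε > (0 : ℝ), ∃ C : ℝ, ∀ a : ℝ, |a| ≤ a₁ * M → ∀ (D : Literature.Geometry.Lorentzian.InitialDataSet 𝓘(ℝ, Literature.Geometry.Lorentzian.E3) (Literature.Geometry.Lorentzian.Kerr.slice a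 M)) [D.metric.HasLeviCivita], D.IsVacuumConstraintSolution → Literature.Geometry.Lorentzian.InitialDataSet.dataWeightedSobolevEDist s δ D (Literature.Geometry.Lorentzian.Kerr.data M a M hM.le) < ENNReal.ofReal ε → ∀ 𝒟 : Literature.Geometry.Lorentzian.VacuumCauchyDevelopment D, 𝒟.IsMaximal → ∃ (M' a' : ℝ) (𝒟oc : Set 𝒟.carrier), Literature.Geometry.Lorentzian.Kerr.IsSubextremal M' a' ∧ (∀ [𝒟.metric.HasLeviCivita], ∃ B₀ : Set (Literature.Geometry.Lorentzian.Kerr.slice a M), IsCompact B₀ ∧ ∀ σ : ℝ, 0 < σ → ∃ B₁ : Set (Literature.Geometry.Lorentzian.Kerr.slice a M), IsCompact B₁ ∧ ∀ q ∈ {q : Literature.Geometry.Lorentzian.Kerr.slice a M | Literature.Geometry.Lorentzian.Kerr.afRadius a M + 1 ≤ ‖(q : Literature.Geometry.Lorentzian.E3)‖}, q ∉ B₁ → ∀ (ray : ℝ → 𝒟.carrier) (dom : Set ℝ), 𝒟.metric.IsNormalisedNullRayFrom 𝒟.timeOrientation 𝒟.embed 𝒟.normal q ray dom → ¬ BddAbove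 dom ∨ ENNReal.ofReal σ ≤ Literature.Geometry.Lorentzian.sojournTime ray dom (𝒟.metric.causalFuture 𝒟.timeOrientation (𝒟.embed '' B₀))) ∧ 𝒟.toSpacetime.ConvergesToKerr 𝒟oc M' a' k ∧ |M' - M| + |a' - a| ≤ C * √(Literature.Geometry.Lorentzian.InitialDataSet.dataWeightedSobolevEDist s δ D (Literature.Geometry.Lorentzian.Kerr.data M a M hM.le)).toReal) → (∀ (X : Type) [TopologicalSpace X] [ChartedSpace Literature.Geometry.Lorentzian.E3 X] [IsManifold (𝓡 3) ((⊤ : ℕ∞) : WithTop ℕ∞) X] [T2Space X] [SecondCountableTopology X] [ConnectedSpace X], Literature.Geometry.Lorentzian.InitialDataSet.IsChristodoulouGeneric (Literature.Geometry.Lorentzian.admissibleVacuumData X) (fun D ↦ (∃ 𝒟 : Literature.Geometry.Lorentzian.VacuumCauchyDevelopment D, 𝒟.IsMaximal) ∧ ∀ 𝒟 : Literature.Geometry.Lorentzian.VacuumCauchyDevelopment D, 𝒟.IsMaximal → Summit.FinalStateConjecture.HasCompleteNullInfinity 𝒟.toCauchyDevelopment) 1) → _root_.FinalStateConjecture) →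 _root_.FinalStateConjecture :=
  fun h₁ h₂ h₃ h₄ ↦ h₄ h₁ h₂ h₃

end Summit.FinalStateConjecture.FinalStateConjecture.Theorems
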